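import Summits.AtomisticToContinuum.Crystallization.Theorems.SquareWellLayerCakeStackingFaultSparsityFarPasteLattice
import Summits.AtomisticToContinuum.Crystallization.Theorems.PricedLinkCensusStackingHingeOfSupportCore

/-!
# `StackingHinge` (stmt-AtomisticToContinuum-14993), line `Sketch` (skeleton v37), stub `stub_dilationPinning` (V6):
# helper file A — uniform discreteness of Hägg stackings and a shell sum

For the dilation pinning of V6 the root energy of a dilated exact stacking
`count|(A '' barlowStacking b (b c) s)` (`s` a Hägg word, `c = h/a₀ ∈ [0.8161, 0.85]`) must be
compared with the hcp level `hcpE a₀ h₀ ≈ -0.7176` at EVERY scale `b > 0`; the extreme scales are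
handled by packing arguments (helper file B, `…DilationPinningScales`), which rest on the two facts of
this file:

* `le_dist_barlowPos_of_isHaggSeq`: distinct points of the stacking of a Hägg word are at distance
  `≥ min a (min √(a²/3 + h²) (2h))` (in-layer `≥ a`, adjacent layers sit over the deep holes, layers two
  apart are `≥ 2h` vertically) — for `c ≥ 0.8161` this is `≥ 0.999·b` (`dist_barlowPos_ge_of_ratio`),
  versus `min a h = 0.82·b` of `le_dist_of_mem_barlowStacking`;
* `sum_inv_dist_pow_six_le_of_far`: a shell sum `∑_{y ∈ T} |p − y|⁻⁶ ≤ 2 (4R/r + 1)³ R⁻⁶` over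
  `r`-separated points at distance `≥ R` from `p` (the packing argument of
  `BenjaminiSchrammLimit.Finset.sum_norm_inv_pow_five_le`, shells of width `R`).

All `[folklore]`.
-/

noncomputable section

namespace Summit.AtomisticToContinuum.Crystallization.Theorems.PricedHcpWindowsDilationPinning

open Literature.MathematicalPhysics.StatisticalMechanics

/-! ## A shell sum beyond radius `R` -/

/-- **Shell sum beyond radius `R`.**  If the points of a finite `T ⊆ ℝ³` are mutually `≥ r > 0` apart
and all at distance `≥ R > 0` from `p`, then `∑_{y ∈ T} |p − y|⁻⁶ ≤ 2 (4R/r + 1)³ R⁻⁶`: the shell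
`⌊|p − y|/R⌋ = m` (`m ≥ 1`) holds at most `(2(m+1)R/r + 1)³ ≤ m³ (4R/r + 1)³` points (packing bound
`card_le_of_separated_of_dist_le`), each contributing `≤ (m R)⁻⁶`, and `∑_{m ≥ 1} m⁻³ ≤ ∑ m⁻² ≤ 2`.
(The argument of `BenjaminiSchrammLimit.Finset.sum_norm_inv_pow_five_le`, shells of width `R`.) [folklore] -/
theorem sum_inv_dist_pow_six_le_of_far (T : Finset (EuclideanSpace ℝ (Fin 3)))
    (p : EuclideanSpace ℝ (Fin 3)) {r R : ℝ} (hr : 0 < r) (hR : 0 < R)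
    (hsep : ∀ y ∈ T, ∀ y' ∈ T, y ≠ y' → r ≤ dist y y') (hfar : ∀ y ∈ T, R ≤ dist p y) :
    ∑ y ∈ T, (dist p y)⁻¹ ^ 6 ≤ 2 * (4 * R / r + 1) ^ 3 * R⁻¹ ^ 6 := by
  classical
  -- adapted from `BenjaminiSchrammLimit.Finset.sum_norm_inv_pow_five_le` (shell width `R`, centre `p`)
  set m : EuclideanSpace ℝ (Fin 3) → ℕ := fun y => ⌊dist p y / R⌋₊ with hm
  set t := T.image m with ht_def
  have hmem : ∀ y ∈ T, m y ∈ t := fun y hy => Finset.mem_image_of_mem m hy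
  have hm1 : ∀ y ∈ T, 1 ≤ m y := fun y hy =>
    (Nat.one_le_floor_iff _).2 ((one_le_div hR).2 (hfar y hy))
  have hmle : ∀ y ∈ T, R * m y ≤ dist p y := fun y hy => by
    have := Nat.floor_le (div_nonneg dist_nonneg hR.le : 0 ≤ dist p y / R)
    rwa [le_div_iff₀ hR, mul_comm] at this
  have hmlt : ∀ y ∈ T, dist p y < (m y + 1) * R := fun y hy => by
    have := Nat.lt_floor_add_one (dist p y / R)
    rwa [div_lt_iff₀ hR] at this
  set K : ℝ := (4 * R / r + 1) ^ 3 * R⁻¹ ^ 6 with hK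
  have hK0 : 0 ≤ K := by positivity
  -- termwise: `|p - y|⁻⁶ ≤ (R m_y)⁻⁶`
  have step1 : ∑ y ∈ T, (dist p y)⁻¹ ^ 6 ≤ ∑ y ∈ T, R⁻¹ ^ 6 * ((m y : ℝ))⁻¹ ^ 6 := by
    refine Finset.sum_le_sum fun y hy => ?_
    rw [← mul_pow, ← mul_inv]
    have h0' : 0 < R * m y := mul_pos hR (by exact_mod_cast hm1 y hy)
    exact pow_le_pow_left₀ (inv_nonneg.2 dist_nonneg) (inv_anti₀ h0' (hmle y hy)) _
  -- regroup by shells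
  have step2 : ∑ y ∈ T, R⁻¹ ^ 6 * ((m y : ℝ))⁻¹ ^ 6 =
      ∑ b ∈ t, ((T.filter fun y => m y = b).card : ℝ) * (R⁻¹ ^ 6 * ((b : ℝ))⁻¹ ^ 6) := by
    have := Finset.sum_fiberwise_of_maps_to' hmem (fun b : ℕ => R⁻¹ ^ 6 * ((b : ℝ))⁻¹ ^ 6)
    simp only [Finset.sum_const, nsmul_eq_mul] at this
    exact this.symm
  -- each shell holds at most `(2(b+1)R/r + 1)³` points
  have step3 : ∀ b ∈ t, ((T.filter fun y => m y = b).card : ℝ) ≤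
      (2 * (((b : ℝ) + 1) * R) / r + 1) ^ 3 := by
    intro b _
    set F := T.filter fun y => m y = b with hF
    have hRb : (0 : ℝ) ≤ ((b : ℝ) + 1) * R := by positivity
    have := card_le_of_separated_of_dist_le F p hr hRb ?_ ?_
    · rw [finrank_euclideanSpace_fin] at this
      exact this
    · intro c hc
      obtain ⟨hcT, hcb⟩ := Finset.mem_filter.1 hc
      have := hmlt c hcT
      rw [hcb] at this
      rw [dist_comm]
      exact this.le
    · intro c hc c' hc' hne
      exact hsep c (Finset.mem_filter.1 hc).1 c' (Finset.mem_filter.1 hc').1 hne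
  -- numerics per shell: `(2(b+1)R/r + 1)³ (bR)⁻⁶ ≤ K b⁻²` for `b ≥ 1`
  have step4 : ∀ b ∈ t, (2 * (((b : ℝ) + 1) * R) / r + 1) ^ 3 * (R⁻¹ ^ 6 * ((b : ℝ))⁻¹ ^ 6) ≤
      K * ((b : ℝ) ^ 2)⁻¹ := by
    intro b hb
    obtain ⟨y, hy, rfl⟩ := Finset.mem_image.1 hb
    have hb1 : (1 : ℝ) ≤ (m y : ℝ) := by exact_mod_cast hm1 y hy
    set β : ℝ := (m y : ℝ)
    have hβ : 0 < β := by linarith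
    have hRr : 0 ≤ R / r := by positivity
    have hlin : 2 * ((β + 1) * R) / r + 1 ≤ β * (4 * R / r + 1) := by
      have e1 : 2 * ((β + 1) * R) / r = 2 * (β + 1) * (R / r) := by ring
      have e2 : 4 * R / r = 4 * (R / r) := by ring
      rw [e1, e2]
      nlinarith [mul_nonneg (sub_nonneg.2 hb1) hRr]
    have hpow : (2 * ((β + 1) * R) / r + 1) ^ 3 ≤ (β * (4 * R / r + 1)) ^ 3 :=
      pow_le_pow_left₀ (by positivity) hlin 3
    have hβ3 : β ^ 3 * (β⁻¹) ^ 6 = (β ^ 3)⁻¹ := by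
      field_simp
    have hinv : (β ^ 3)⁻¹ ≤ (β ^ 2)⁻¹ :=
      inv_anti₀ (pow_pos hβ 2) (pow_le_pow_right₀ hb1 (by norm_num : 2 ≤ 3))
    calc (2 * ((β + 1) * R) / r + 1) ^ 3 * (R⁻¹ ^ 6 * (β⁻¹) ^ 6)
        ≤ (β * (4 * R / r + 1)) ^ 3 * (R⁻¹ ^ 6 * (β⁻¹) ^ 6) :=
          mul_le_mul_of_nonneg_right hpow (by positivity)
      _ = K * (β ^ 3 * (β⁻¹) ^ 6) := by rw [hK]; ring
      _ ≤ K * (β ^ 2)⁻¹ := by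
          rw [hβ3]
          exact mul_le_mul_of_nonneg_left hinv hK0
  -- `∑_{b ∈ t} b⁻² ≤ 2`
  have step5 : ∑ b ∈ t, ((b : ℝ) ^ 2)⁻¹ ≤ 2 := by
    have hsub : t ⊆ Finset.Ioo 0 (t.sup id + 1) := fun b hb => by
      rw [Finset.mem_Ioo]
      obtain ⟨y, hy, rfl⟩ := Finset.mem_image.1 hb
      exact ⟨hm1 y hy, Nat.lt_succ_of_le (Finset.le_sup (f := id) hb)⟩
    have h2 := sum_Ioo_inv_sq_le (α := ℝ) 0 (t.sup id + 1)
    calc ∑ b ∈ t, ((b : ℝ) ^ 2)⁻¹ ≤ ∑ b ∈ Finset.Ioo 0 (t.sup id + 1), ((b : ℝ) ^ 2)⁻¹ :=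
          Finset.sum_le_sum_of_subset_of_nonneg hsub fun b _ _ => by positivity
      _ ≤ 2 := by simpa using h2
  calc ∑ y ∈ T, (dist p y)⁻¹ ^ 6
      ≤ ∑ b ∈ t, ((T.filter fun y => m y = b).card : ℝ) * (R⁻¹ ^ 6 * ((b : ℝ))⁻¹ ^ 6) :=
        step1.trans_eq step2
    _ ≤ ∑ b ∈ t, (2 * (((b : ℝ) + 1) * R) / r + 1) ^ 3 * (R⁻¹ ^ 6 * ((b : ℝ))⁻¹ ^ 6) :=
        Finset.sum_le_sum fun b hb => mul_le_mul_of_nonneg_right (step3 b hb) (by positivity)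
    _ ≤ ∑ b ∈ t, K * ((b : ℝ) ^ 2)⁻¹ := Finset.sum_le_sum step4
    _ = K * ∑ b ∈ t, ((b : ℝ) ^ 2)⁻¹ := by rw [Finset.mul_sum]
    _ ≤ K * 2 := mul_le_mul_of_nonneg_left step5 hK0
    _ = 2 * (4 * R / r + 1) ^ 3 * R⁻¹ ^ 6 := by rw [hK]; ring

/-! ## Uniform discreteness of the stacking of a Hägg word -/

/-- The integer form behind the adjacent-layer distances: `p² + pq + q² + δ(p + q) ≥ 0` for integers
`p, q` and `δ = ±1` (twice it is `(p + q + δ)² + p² + q² − 1`, and `p, q, p + q + δ` do not all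
vanish). [folklore] -/
theorem int_form_adjacent_nonneg (p q δ : ℤ) (hδ : δ = 1 ∨ δ = -1) :
    0 ≤ p ^ 2 + p * q + q ^ 2 + δ * (p + q) := by
  have hδ2 : δ ^ 2 = 1 := by rcases hδ with rfl | rfl <;> norm_num
  have key : 2 * (p ^ 2 + p * q + q ^ 2 + δ * (p + q)) = (p + q + δ) ^ 2 + p ^ 2 + q ^ 2 - 1 := by
    linear_combination (-1 : ℤ) * hδ2
  have h1 : 1 ≤ (p + q + δ) ^ 2 + p ^ 2 + q ^ 2 := by
    by_cases hp : p = 0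
    · by_cases hq : q = 0
      · subst hp; subst hq; simp [hδ2]
      · nlinarith [Int.one_le_abs hq, sq_abs q, sq_nonneg (p + q + δ), sq_nonneg p]
    · nlinarith [Int.one_le_abs hp, sq_abs p, sq_nonneg (p + q + δ), sq_nonneg q]
  linarith

/-- `(a √3/2 · y)² = (3/4) a² y²`. [folklore] -/
theorem sq_mul_sqrt_three (a y : ℝ) : (a * Real.sqrt 3 / 2 * y) ^ 2 = 3 / 4 * (a ^ 2 * y ^ 2) := by
  rw [show a * Real.sqrt 3 / 2 * y = Real.sqrt 3 * (a * y / 2) by ring, mul_pow,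
    Real.sq_sqrt (by norm_num : (0 : ℝ) ≤ 3)]
  ring

/-- **Uniform discreteness of the stacking of a Hägg word.**  For `a, h ≥ 0` and a `±1` word `s`,
distinct points of `barlowStacking a h s` are at distance `≥ min a (min √(a²/3 + h²) (2h))`: two points of
one layer are `≥ a` apart (`le_dist_barlowPos_of_ne`); points of layers two or more apart differ by
`≥ 2h` in height; and a point of layer `k ± 1` is laterally offset from layer `k` by `± w` modulo the
layer lattice, so that its squared distance to any point of layer `k` is
`a² (p² + pq + q² ± (p + q) + 1/3) + h² ≥ a²/3 + h²` (`int_form_adjacent_nonneg`). [folklore] -/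
theorem le_dist_barlowPos_of_isHaggSeq {a h : ℝ} (ha : 0 ≤ a) (hh : 0 ≤ h) {s : ℤ → ℤ}
    (hs : IsHaggSeq s) {k i j k' i' j' : ℤ} (hne : (k, i, j) ≠ (k', i', j')) :
    min a (min (Real.sqrt (a ^ 2 / 3 + h ^ 2)) (2 * h)) ≤
      dist (barlowPos a h s k i j) (barlowPos a h s k' i' j') := by
  by_cases hk : k = k'
  · subst hk
    have hij : (i, j) ≠ (i', j') := by
      rintro h0
      apply hne
      rw [Prod.mk.injEq] at h0
      rw [h0.1, h0.2]
    exact (min_le_left _ _).trans (le_dist_barlowPos_of_ne a h s ha hij)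
  refine (min_le_right _ _).trans ?_
  -- the vertical component
  have hvert : |(k : ℝ) - k'| * h ≤ dist (barlowPos a h s k i j) (barlowPos a h s k' i' j') := by
    refine le_trans ?_ (PiLp.dist_apply_le (barlowPos a h s k i j) (barlowPos a h s k' i' j') 2)
    rw [barlowPos_apply_two, barlowPos_apply_two, Real.dist_eq, ← sub_mul, abs_mul, abs_of_nonneg hh]
  by_cases h2 : 2 ≤ |k - k'|
  · refine (min_le_right _ _).trans (le_trans ?_ hvert)
    have h2' : (2 : ℝ) ≤ |(k : ℝ) - k'| := by
      rw [← Int.cast_sub, ← Int.cast_abs]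
      exact_mod_cast h2
    nlinarith
  refine (min_le_left _ _).trans ?_
  -- adjacent layers: `|k - k'| = 1`, the label difference is `±1`
  have h1 : |k - k'| = 1 := by
    have h0 : k - k' ≠ 0 := sub_ne_zero.2 hk
    have := Int.one_le_abs h0
    omega
  have hkkZ : (k - k') ^ 2 = 1 := by rw [← sq_abs, h1]; norm_num
  have hkkR : ((k : ℝ) - k') ^ 2 = 1 := by exact_mod_cast hkkZ
  have hδ : haggLabel s k - haggLabel s k' = 1 ∨ haggLabel s k - haggLabel s k' = -1 := by
    rcases (abs_eq (by norm_num : (0 : ℤ) ≤ 1)).1 h1 with hkk | hkk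
    · have hk' : k = k' + 1 := by omega
      rw [hk', haggLabel_succ]
      rcases hs k' with h' | h' <;> rw [h'] <;> [left; right] <;> ring
    · have hk' : k' = k + 1 := by omega
      rw [hk', haggLabel_succ]
      rcases hs k with h' | h' <;> rw [h'] <;> [right; left] <;> ring
  have hsq : a ^ 2 / 3 + h ^ 2 ≤ dist (barlowPos a h s k i j) (barlowPos a h s k' i' j') ^ 2 := by
    have hX := int_form_adjacent_nonneg (i - i') (j - j') (haggLabel s k - haggLabel s k') hδ
    have hXR : (0 : ℝ) ≤ ((i : ℝ) - i') ^ 2 + ((i : ℝ) - i') * ((j : ℝ) - j') + ((j : ℝ) - j') ^ 2 +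
        ((haggLabel s k : ℝ) - haggLabel s k') * (((i : ℝ) - i') + ((j : ℝ) - j')) := by
      exact_mod_cast hX
    have hD : ((haggLabel s k : ℝ) - haggLabel s k') ^ 2 = 1 := by
      rcases hδ with hd | hd
      · have : ((haggLabel s k : ℝ) - haggLabel s k') = 1 := by exact_mod_cast hd
        rw [this]; norm_num
      · have : ((haggLabel s k : ℝ) - haggLabel s k') = -1 := by exact_mod_cast hd
        rw [this]; norm_num
    rw [dist_barlowPos_sq, sq_mul_sqrt_three,
      show (((k : ℝ) - k') * h) ^ 2 = ((k : ℝ) - k') ^ 2 * h ^ 2 by ring, hkkR]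
    nlinarith [mul_nonneg (sq_nonneg a) hXR, hD, sq_nonneg a]
  calc Real.sqrt (a ^ 2 / 3 + h ^ 2)
      ≤ Real.sqrt (dist (barlowPos a h s k i j) (barlowPos a h s k' i' j') ^ 2) := Real.sqrt_le_sqrt hsq
    _ = dist (barlowPos a h s k i j) (barlowPos a h s k' i' j') := Real.sqrt_sq dist_nonneg

/-- In-layer distances from the base point: `|barlowPos k 0 0 − barlowPos k i j|² = a² (i² + ij + j²)`.
[folklore] -/
theorem dist_barlowPos_inLayer_sq (a h : ℝ) (s : ℤ → ℤ) (k i j : ℤ) :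
    dist (barlowPos a h s k 0 0) (barlowPos a h s k i j) ^ 2 = a ^ 2 * ((i : ℝ) ^ 2 + i * j + j ^ 2) := by
  rw [dist_barlowPos_sq, sq_mul_sqrt_three]
  push_cast
  ring


/-! ## The separation at the working ratios -/

/-- At layer ratios `h'/b ≥ 0.8161` distinct parameter triples of the stacking of a Hägg word give
points at distance `≥ 0.999 b` (`le_dist_barlowPos_of_isHaggSeq`: `√(1/3 + 0.8161²) ≥ 0.999`,
`2 · 0.8161 ≥ 0.999`). [folklore] -/
theorem dist_barlowPos_ge_of_ratio {b h' : ℝ} (hb : 0 < b) (hlo : 8161 / 10000 * b ≤ h')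
    {s : ℤ → ℤ} (hs : IsHaggSeq s) {q q' : ℤ × ℤ × ℤ} (hne : q ≠ q') :
    999 / 1000 * b ≤ dist (barlowPos b h' s q.1 q.2.1 q.2.2) (barlowPos b h' s q'.1 q'.2.1 q'.2.2) := by
  obtain ⟨k, i, j⟩ := q
  obtain ⟨k', i', j'⟩ := q'
  have hh' : 0 ≤ h' := by nlinarith
  refine le_trans (le_min (by linarith) (le_min ?_ (by linarith)))
    (le_dist_barlowPos_of_isHaggSeq hb.le hh' hs hne)
  refine (Real.le_sqrt (by positivity) (by positivity)).2 ?_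
  nlinarith [mul_le_mul hlo hlo (by positivity) hh']

end Summit.AtomisticToContinuum.Crystallization.Theorems.PricedHcpWindowsDilationPinning

end
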